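import Literature.NumberTheory.IwasawaTheory.NarrowFukudaElementaryInclusion
import Literature.NumberTheory.NumberFields.NarrowClassGroupRingEquiv
import Literature.NumberTheory.IwasawaTheory.ClassicalMuInvariant
import HarnessLib

/-!
# Narrow Fukuda (Thm. 1 (2) for narrow class groups) at finite level — the PER-LAYER class-field-theoretic RANK data:
# for `K_n ⊆ K_{n+j} ⊆ K_{n+t} ⊆ K¹(K_{n+t})`, `[Gal(K¹/K_{n+j}) : N_j·G_j^p] = [Cl⁺(K_{n+j}) : Cl⁺(K_{n+j})^p]`

Topic `NumberTheory/IwasawaTheory` (namespace = path). THEOREM-ONLY file (no definition, no named fact, no `sorry`), written by the prover seat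
`cruxlead-stmt-BirchSwinnertonDyer-19573-w2` GEN 9 (cell `bsd-2adic`; `--supports` stmt-BirchSwinnertonDyer-19573; closes nothing). Third brick of
«NARROW FUKUDA»: the NARROW twin of `Fukuda1994Thm1RankLayer.exists_layer` (seat `bsd-potss-k8t-c4` g20, followed line by line), with two
simplifications forced by the narrow setting: (i) the ambient field is the whole big Hilbert class field `K¹ = K¹(K_{n+t}) = narrowRayClassField K_{n+t} ⊤`
(maximal abelian extension unramified at the FINITE primes, degree `h⁺(K_{n+t})`; no `p`-part is taken, since the rank statement needs none),
and (ii) only the RANK datum is produced (the order datum `[G_j : N_j] = p^{e⁺}` is not needed for Thm. 1 (2)).  INTERFACE: the caller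
(`NarrowFukudaRankPackage`) has built, for the top layer `T = K_{n+t}`, the base `B = K_n ⊆ T` (`Bi`, `[B : K] = p^n`), knows `K¹/B` Galois,
the subgroup `A' = Gal(K¹/T)` of `G = Gal(K¹/B)` (given by its fixed elements) and the family `𝓘` of the inertia groups of the maximal ideals of
`𝓞 K¹` in `G`.  OUTPUT (`exists_layer`): for `j ≤ t`, the subgroup `G_j = Gal(K¹/K_{n+j}) ≤ G` (image of restriction of scalars from the model
`F_j ⊆ T` of `K_{n+j}`) contains `A'`, has index `p^j`, and **`[G_j : N_j·P_j] = [Cl⁺(K_{n+j}) : Cl⁺(K_{n+j})^p]`** where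
`N_j = G_j'·⟨I ∩ G_j : I ∈ 𝓘⟩`, `P_j` = `p`-th powers (bricks `index_sup_pow_dvd_index_range_pow_narrowClassGroup` and
`index_range_pow_narrowClassGroup_dvd_index_commutator_sup_inertia_sup_pow`, transported to `K_{n+j}` along `F_j ≅ K_{n+j}` by
`index_range_pow_narrowClassGroup_eq_of_ringEquiv`).

References: [Fukuda1994] Thm. 1 (2), p. 264; [Washington1997] §13.3 Lemmas 13.15, 13.18, Prop. 13.23; [NeukirchANT1999] Ch. VI §6 Prop. (6.8);
[GreenbergLNM1716] p. 122.
-/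

noncomputable section

open scoped NumberField IsMulCommutative
open NumberField IsDedekindDomain Field IntermediateField

namespace Literature.NumberTheory.IwasawaTheory

open Literature.NumberTheory.EllipticCurves Literature.NumberTheory.GaloisRepresentations
  Literature.NumberTheory.NumberFields

variable {K : Type} [Field K] [NumberField K] {p : ℕ} [hp : Fact p.Prime]

/-- A subgroup containing the commutator subgroup is normal. [folklore] -/
private theorem normal_of_commutator_le {G : Type*} [Group G] {N : Subgroup G} (h : ⁅(⊤ : Subgroup G), ⊤⁆ ≤ N) :
    N.Normal :=
  ⟨fun m hm g => by
    have h2 := Subgroup.commutator_mem_commutator (Subgroup.mem_top g) (Subgroup.mem_top m)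
    rw [commutatorElement_def] at h2
    have h1 : g * m * g⁻¹ = g * m * g⁻¹ * m⁻¹ * m := by group
    rw [h1]
    exact mul_mem (h h2) hm⟩


/-- Brick (D⁺) with the `M`-algebra structure of `K¹(F)` as an explicit argument (the layer sees `K¹(K_{n+t})` through the algebra instance
inherited from `F_j ⊆ K_{n+t}`, which is only definitionally the one of the brick). [folklore] -/
private theorem dvd_index_of_algebra_eq (M F : Type) [Field M] [NumberField M] [Field F] [NumberField F] [Algebra M F]
    [IsGalois M F] (p : ℕ) (alg : Algebra M (narrowRayClassField F (top_ne_bot : (⊤ : Ideal (𝓞 F)) ≠ ⊥))) (halg : alg = IntermediateField.algebra' (narrowRayClassField F (top_ne_bot : (⊤ : Ideal (𝓞 F)) ≠ ⊥)))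
    (hG : @IsGalois M _ (narrowRayClassField F (top_ne_bot : (⊤ : Ideal (𝓞 F)) ≠ ⊥)) _ alg) :
    letI := alg
    (powMonoidHom (α := NarrowClassGroup M) p).range.index ∣
      ((⁅(⊤ : Subgroup ((narrowRayClassField F (top_ne_bot : (⊤ : Ideal (𝓞 F)) ≠ ⊥)) ≃ₐ[M] (narrowRayClassField F (top_ne_bot : (⊤ : Ideal (𝓞 F)) ≠ ⊥)))), ⊤⁆ ⊔
        ⨆ (Q : MaximalSpectrum (𝓞 (narrowRayClassField F (top_ne_bot : (⊤ : Ideal (𝓞 F)) ≠ ⊥)))), Q.asIdeal.inertia ((narrowRayClassField F (top_ne_bot : (⊤ : Ideal (𝓞 F)) ≠ ⊥)) ≃ₐ[M] (narrowRayClassField F (top_ne_bot : (⊤ : Ideal (𝓞 F)) ≠ ⊥)))) ⊔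
        Subgroup.closure (Set.range fun σ : (narrowRayClassField F (top_ne_bot : (⊤ : Ideal (𝓞 F)) ≠ ⊥)) ≃ₐ[M] (narrowRayClassField F (top_ne_bot : (⊤ : Ideal (𝓞 F)) ≠ ⊥)) => σ ^ p)).index := by
  subst halg
  exact index_range_pow_narrowClassGroup_dvd_index_commutator_sup_inertia_sup_pow M F p

set_option maxHeartbeats 40000000 in
set_option synthInstance.maxHeartbeats 400000 in
/-- **The layer `G_j = Gal(K¹/K_{n+j})` of `Gal(K¹/K_n)` (`K¹ = K¹(K_{n+t})` the big Hilbert class field of the top layer): contains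
`A' = Gal(K¹/K_{n+t})`, has index `p^j`, and `[G_j : N_j·P_j] = [Cl⁺(K_{n+j}) : Cl⁺(K_{n+j})^p]`** (interface described in the module docstring).
[cite: Fukuda1994, Thm. 1 (2), p. 264 (proof)] [cite: Washington1997, §13.3 Lemmas 13.15 and 13.18, Prop. 13.23]
[cite: NeukirchANT1999, Ch. VI §6 Prop. (6.8)] -/
theorem NarrowFukuda.exists_layer (κ : ZpExtension K p) (n t j : ℕ) (hj : j ≤ t)
    [FiniteDimensional K (κ.layer (n + t))] [IsGalois K (κ.layer (n + t))] [NumberField (κ.layer (n + t))]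
    [NumberField (κ.layer (n + j))]
    (Bi : IntermediateField K (κ.layer (n + t))) (hBi : Bi = IntermediateField.restrict (κ.layer_mono (Nat.le_add_right n t)))
    [FiniteDimensional K Bi] [IsGalois K Bi] [NumberField Bi] [IsGalois Bi (κ.layer (n + t))]
    (hdegKB : Module.finrank K Bi = p ^ n)
    [IsGalois Bi (narrowRayClassField (κ.layer (n + t)) (top_ne_bot : (⊤ : Ideal (𝓞 (κ.layer (n + t)))) ≠ ⊥))] [FiniteDimensional Bi (narrowRayClassField (κ.layer (n + t)) (top_ne_bot : (⊤ : Ideal (𝓞 (κ.layer (n + t)))) ≠ ⊥))]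
    (A' : Subgroup ((narrowRayClassField (κ.layer (n + t)) (top_ne_bot : (⊤ : Ideal (𝓞 (κ.layer (n + t)))) ≠ ⊥)) ≃ₐ[Bi] (narrowRayClassField (κ.layer (n + t)) (top_ne_bot : (⊤ : Ideal (𝓞 (κ.layer (n + t)))) ≠ ⊥))))
    (hmemA' : ∀ g : (narrowRayClassField (κ.layer (n + t)) (top_ne_bot : (⊤ : Ideal (𝓞 (κ.layer (n + t)))) ≠ ⊥)) ≃ₐ[Bi] (narrowRayClassField (κ.layer (n + t)) (top_ne_bot : (⊤ : Ideal (𝓞 (κ.layer (n + t)))) ≠ ⊥)), g ∈ A' ↔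
      ∀ x : (κ.layer (n + t)), g (algebraMap (κ.layer (n + t)) (narrowRayClassField (κ.layer (n + t)) (top_ne_bot : (⊤ : Ideal (𝓞 (κ.layer (n + t)))) ≠ ⊥)) x) = algebraMap (κ.layer (n + t)) (narrowRayClassField (κ.layer (n + t)) (top_ne_bot : (⊤ : Ideal (𝓞 (κ.layer (n + t)))) ≠ ⊥)) x)
    (𝓘 : Set (Subgroup ((narrowRayClassField (κ.layer (n + t)) (top_ne_bot : (⊤ : Ideal (𝓞 (κ.layer (n + t)))) ≠ ⊥)) ≃ₐ[Bi] (narrowRayClassField (κ.layer (n + t)) (top_ne_bot : (⊤ : Ideal (𝓞 (κ.layer (n + t)))) ≠ ⊥)))))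
    (h𝓘def : 𝓘 = Set.range (fun Q : MaximalSpectrum (𝓞 (narrowRayClassField (κ.layer (n + t)) (top_ne_bot : (⊤ : Ideal (𝓞 (κ.layer (n + t)))) ≠ ⊥))) => Q.asIdeal.inertia ((narrowRayClassField (κ.layer (n + t)) (top_ne_bot : (⊤ : Ideal (𝓞 (κ.layer (n + t)))) ≠ ⊥)) ≃ₐ[Bi] (narrowRayClassField (κ.layer (n + t)) (top_ne_bot : (⊤ : Ideal (𝓞 (κ.layer (n + t)))) ≠ ⊥))))) :
    ∃ Gj : Subgroup ((narrowRayClassField (κ.layer (n + t)) (top_ne_bot : (⊤ : Ideal (𝓞 (κ.layer (n + t)))) ≠ ⊥)) ≃ₐ[Bi] (narrowRayClassField (κ.layer (n + t)) (top_ne_bot : (⊤ : Ideal (𝓞 (κ.layer (n + t)))) ≠ ⊥))), A' ≤ Gj ∧ Gj.index = p ^ j ∧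
      ((⁅Gj, Gj⁆ ⊔ ⨆ I ∈ 𝓘, I ⊓ Gj) ⊔ Subgroup.closure ((fun x : (narrowRayClassField (κ.layer (n + t)) (top_ne_bot : (⊤ : Ideal (𝓞 (κ.layer (n + t)))) ≠ ⊥)) ≃ₐ[Bi] (narrowRayClassField (κ.layer (n + t)) (top_ne_bot : (⊤ : Ideal (𝓞 (κ.layer (n + t)))) ≠ ⊥)) => x ^ p) '' (Gj : Set ((narrowRayClassField (κ.layer (n + t)) (top_ne_bot : (⊤ : Ideal (𝓞 (κ.layer (n + t)))) ≠ ⊥)) ≃ₐ[Bi] (narrowRayClassField (κ.layer (n + t)) (top_ne_bot : (⊤ : Ideal (𝓞 (κ.layer (n + t)))) ≠ ⊥)))))).relIndex Gj =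
        (powMonoidHom (α := NarrowClassGroup (κ.layer (n + j))) p).range.index := by
  classical
  have hp0 : 0 < p := hp.out.pos
  haveI : FiniteDimensional K (κ.layer (n + j)) := κ.finiteDimensional_layer_holds (n + j)
  haveI : IsGalois K (κ.layer (n + j)) := κ.isGalois_layer_holds (n + j)
  have hBFj : κ.layer n ≤ κ.layer (n + j) := κ.layer_mono (Nat.le_add_right n j)
  have hFjF : κ.layer (n + j) ≤ κ.layer (n + t) := κ.layer_mono (by omega)
  obtain ⟨Fji, hFji⟩ : ∃ Fji : IntermediateField K (κ.layer (n + t)), Fji = IntermediateField.restrict hFjF := ⟨_, rfl⟩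
  have hBiFji : Bi ≤ Fji := by
    intro x hx
    rw [hBi, IntermediateField.mem_restrict] at hx
    rw [hFji, IntermediateField.mem_restrict]
    exact hBFj hx
  let eFj : (κ.layer (n + j)) ≃ₐ[K] Fji :=
    (IntermediateField.restrict_algEquiv hFjF).trans (IntermediateField.equivOfEq hFji.symm)
  obtain ⟨Fje, hFje⟩ : ∃ Fje : IntermediateField Bi (κ.layer (n + t)), Fje = IntermediateField.extendScalars hBiFji :=
    ⟨_, rfl⟩
  have hmemFje : ∀ x : (κ.layer (n + t)), x ∈ Fje ↔ x ∈ Fji := fun x => by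
    rw [hFje, IntermediateField.mem_extendScalars]
  let eFje : Fji ≃+* Fje :=
    { toFun := fun x => ⟨x, (hmemFje _).mpr x.2⟩
      invFun := fun x => ⟨x, (hmemFje _).mp x.2⟩
      left_inv := fun _ => rfl
      right_inv := fun _ => rfl
      map_mul' := fun _ _ => rfl
      map_add' := fun _ _ => rfl }
  haveI : FiniteDimensional K Fji := LinearEquiv.finiteDimensional eFj.toLinearEquiv
  haveI : IsGalois K Fji := IsGalois.of_algEquiv eFj
  haveI : NumberField Fji := NumberField.of_module_finite K _
  haveI hFjefd : FiniteDimensional K Fje := by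
    have : FiniteDimensional K (Fje.restrictScalars K) := by rw [hFje, IntermediateField.extendScalars_restrictScalars]; infer_instance
    exact this
  haveI : IsGalois K Fje := by
    have : IsGalois K (Fje.restrictScalars K) := by rw [hFje, IntermediateField.extendScalars_restrictScalars]; infer_instance
    exact this
  haveI : NumberField Fje := NumberField.of_module_finite K _
  haveI : IsGalois Bi Fje := IsGalois.tower_top_of_isGalois K Bi Fje
  haveI : IsScalarTower K Fje (κ.layer (n + t)) := IsScalarTower.of_algebraMap_eq fun _ => rfl
  haveI : IsGalois Fje (κ.layer (n + t)) := IsGalois.tower_top_of_isGalois K Fje (κ.layer (n + t))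
  -- scalar towers for `K¹` over `F_j`
  haveI : IsScalarTower Bi Fje (narrowRayClassField (κ.layer (n + t)) (top_ne_bot : (⊤ : Ideal (𝓞 (κ.layer (n + t)))) ≠ ⊥)) := IsScalarTower.of_algebraMap_eq fun _ => rfl
  haveI : IsScalarTower K Fje (narrowRayClassField (κ.layer (n + t)) (top_ne_bot : (⊤ : Ideal (𝓞 (κ.layer (n + t)))) ≠ ⊥)) := IsScalarTower.of_algebraMap_eq fun _ => rfl
  haveI : IsGalois Fje (narrowRayClassField (κ.layer (n + t)) (top_ne_bot : (⊤ : Ideal (𝓞 (κ.layer (n + t)))) ≠ ⊥)) := IsGalois.tower_top_of_isGalois Bi Fje (narrowRayClassField (κ.layer (n + t)) (top_ne_bot : (⊤ : Ideal (𝓞 (κ.layer (n + t)))) ≠ ⊥))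
  haveI : Module.Free Fje (narrowRayClassField (κ.layer (n + t)) (top_ne_bot : (⊤ : Ideal (𝓞 (κ.layer (n + t)))) ≠ ⊥)) := Module.Free.of_divisionRing Fje (narrowRayClassField (κ.layer (n + t)) (top_ne_bot : (⊤ : Ideal (𝓞 (κ.layer (n + t)))) ≠ ⊥))
  haveI : Module.Free Bi Fje := Module.Free.of_divisionRing Bi Fje
  haveI : Module.Free Bi (narrowRayClassField (κ.layer (n + t)) (top_ne_bot : (⊤ : Ideal (𝓞 (κ.layer (n + t)))) ≠ ⊥)) := Module.Free.of_divisionRing Bi (narrowRayClassField (κ.layer (n + t)) (top_ne_bot : (⊤ : Ideal (𝓞 (κ.layer (n + t)))) ≠ ⊥))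
  -- degrees
  have hdegBFj : Module.finrank Bi Fje = p ^ j := by
    have h := Module.finrank_mul_finrank K Bi Fje
    have h2 : Module.finrank K Fje = p ^ (n + j) := by
      have : Module.finrank K (Fje.restrictScalars K) = Module.finrank K Fji := by
        rw [hFje, IntermediateField.extendScalars_restrictScalars]
      rw [← κ.finrank_layer_holds (n + j), eFj.toLinearEquiv.finrank_eq, ← this]; rfl
    rw [hdegKB, h2, pow_add] at h
    exact Nat.eq_of_mul_eq_mul_left (pow_pos hp0 n) h
  -- narrow class group transport `Cl⁺(F_j) ≅ Cl⁺(K_{n+j})` on `p`-ranks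
  have hrkFj : (powMonoidHom (α := NarrowClassGroup Fje) p).range.index =
      (powMonoidHom (α := NarrowClassGroup (κ.layer (n + j))) p).range.index :=
    (index_range_pow_narrowClassGroup_eq_of_ringEquiv (eFj.toRingEquiv.trans eFje) p).symm
  -- class field theory over `F_j` (narrow rank bricks)
  have hDr := dvd_index_of_algebra_eq Fje (κ.layer (n + t)) p inferInstance (Algebra.algebra_ext _ _ fun _ => rfl) inferInstance
  -- the Galois group `G_j = Gal(K¹/F_j)` as the image of restriction of scalars
  let ρj : ((narrowRayClassField (κ.layer (n + t)) (top_ne_bot : (⊤ : Ideal (𝓞 (κ.layer (n + t)))) ≠ ⊥)) ≃ₐ[Fje] (narrowRayClassField (κ.layer (n + t)) (top_ne_bot : (⊤ : Ideal (𝓞 (κ.layer (n + t)))) ≠ ⊥))) →* ((narrowRayClassField (κ.layer (n + t)) (top_ne_bot : (⊤ : Ideal (𝓞 (κ.layer (n + t)))) ≠ ⊥)) ≃ₐ[Bi] (narrowRayClassField (κ.layer (n + t)) (top_ne_bot : (⊤ : Ideal (𝓞 (κ.layer (n + t)))) ≠ ⊥))) :=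
    { toFun := fun σ => σ.restrictScalars Bi
      map_one' := rfl
      map_mul' := fun _ _ => rfl }
  have hρj_inj : Function.Injective ρj := fun σ τ h => AlgEquiv.restrictScalars_injective Bi h
  obtain ⟨Gj, hGj⟩ : ∃ Gj : Subgroup ((narrowRayClassField (κ.layer (n + t)) (top_ne_bot : (⊤ : Ideal (𝓞 (κ.layer (n + t)))) ≠ ⊥)) ≃ₐ[Bi] (narrowRayClassField (κ.layer (n + t)) (top_ne_bot : (⊤ : Ideal (𝓞 (κ.layer (n + t)))) ≠ ⊥))), Gj = ρj.range := ⟨_, rfl⟩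
  have hGjcard' : Nat.card ((narrowRayClassField (κ.layer (n + t)) (top_ne_bot : (⊤ : Ideal (𝓞 (κ.layer (n + t)))) ≠ ⊥)) ≃ₐ[Fje] (narrowRayClassField (κ.layer (n + t)) (top_ne_bot : (⊤ : Ideal (𝓞 (κ.layer (n + t)))) ≠ ⊥))) * p ^ j = Nat.card ((narrowRayClassField (κ.layer (n + t)) (top_ne_bot : (⊤ : Ideal (𝓞 (κ.layer (n + t)))) ≠ ⊥)) ≃ₐ[Bi] (narrowRayClassField (κ.layer (n + t)) (top_ne_bot : (⊤ : Ideal (𝓞 (κ.layer (n + t)))) ≠ ⊥))) := by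
    have h1 := Module.finrank_mul_finrank Bi Fje (narrowRayClassField (κ.layer (n + t)) (top_ne_bot : (⊤ : Ideal (𝓞 (κ.layer (n + t)))) ≠ ⊥))
    rw [hdegBFj] at h1
    rw [IsGalois.card_aut_eq_finrank, IsGalois.card_aut_eq_finrank, mul_comm]
    exact h1
  have hGjindex : Gj.index = p ^ j := by
    rw [hGj]
    have h1 := ρj.range.index_mul_card
    rw [← Nat.card_congr (MonoidHom.ofInjective hρj_inj).toEquiv, ← hGjcard', mul_comm] at h1
    exact Nat.eq_of_mul_eq_mul_left Nat.card_pos h1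
  have hA'Gj : A' ≤ Gj := by
    intro x hx
    rw [hGj]
    exact ⟨{ x with commutes' := fun y => (hmemA' x).mp hx (y : κ.layer (n + t)) }, AlgEquiv.ext fun _ => rfl⟩
  -- the norm group `N_j ≤ Gal(K¹/F_j)` and its `p`-power companion: index `[Cl⁺(F_j) : Cl⁺(F_j)^p]`
  obtain ⟨Nj, hNj⟩ : ∃ Nj : Subgroup ((narrowRayClassField (κ.layer (n + t)) (top_ne_bot : (⊤ : Ideal (𝓞 (κ.layer (n + t)))) ≠ ⊥)) ≃ₐ[Fje] (narrowRayClassField (κ.layer (n + t)) (top_ne_bot : (⊤ : Ideal (𝓞 (κ.layer (n + t)))) ≠ ⊥))), Nj =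
      ⁅(⊤ : Subgroup ((narrowRayClassField (κ.layer (n + t)) (top_ne_bot : (⊤ : Ideal (𝓞 (κ.layer (n + t)))) ≠ ⊥)) ≃ₐ[Fje] (narrowRayClassField (κ.layer (n + t)) (top_ne_bot : (⊤ : Ideal (𝓞 (κ.layer (n + t)))) ≠ ⊥)))), ⊤⁆ ⊔ ⨆ (Q : MaximalSpectrum (𝓞 (narrowRayClassField (κ.layer (n + t)) (top_ne_bot : (⊤ : Ideal (𝓞 (κ.layer (n + t)))) ≠ ⊥)))), Q.asIdeal.inertia ((narrowRayClassField (κ.layer (n + t)) (top_ne_bot : (⊤ : Ideal (𝓞 (κ.layer (n + t)))) ≠ ⊥)) ≃ₐ[Fje] (narrowRayClassField (κ.layer (n + t)) (top_ne_bot : (⊤ : Ideal (𝓞 (κ.layer (n + t)))) ≠ ⊥))) :=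
    ⟨_, rfl⟩
  haveI hNjn : Nj.Normal := by rw [hNj]; exact normal_of_commutator_le le_sup_left
  have hIN : ∀ (Q : Ideal (𝓞 (narrowRayClassField (κ.layer (n + t)) (top_ne_bot : (⊤ : Ideal (𝓞 (κ.layer (n + t)))) ≠ ⊥)))) [Q.IsMaximal], Q.inertia ((narrowRayClassField (κ.layer (n + t)) (top_ne_bot : (⊤ : Ideal (𝓞 (κ.layer (n + t)))) ≠ ⊥)) ≃ₐ[Fje] (narrowRayClassField (κ.layer (n + t)) (top_ne_bot : (⊤ : Ideal (𝓞 (κ.layer (n + t)))) ≠ ⊥))) ≤ Nj := fun Q _ => by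
    rw [hNj]
    exact le_sup_of_le_right
      (le_iSup (fun Q : MaximalSpectrum (𝓞 (narrowRayClassField (κ.layer (n + t)) (top_ne_bot : (⊤ : Ideal (𝓞 (κ.layer (n + t)))) ≠ ⊥))) => Q.asIdeal.inertia ((narrowRayClassField (κ.layer (n + t)) (top_ne_bot : (⊤ : Ideal (𝓞 (κ.layer (n + t)))) ≠ ⊥)) ≃ₐ[Fje] (narrowRayClassField (κ.layer (n + t)) (top_ne_bot : (⊤ : Ideal (𝓞 (κ.layer (n + t)))) ≠ ⊥)))) ⟨Q, ‹_›⟩)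
  have hCjr : (Nj ⊔ Subgroup.closure (Set.range fun σ : (narrowRayClassField (κ.layer (n + t)) (top_ne_bot : (⊤ : Ideal (𝓞 (κ.layer (n + t)))) ≠ ⊥)) ≃ₐ[Fje] (narrowRayClassField (κ.layer (n + t)) (top_ne_bot : (⊤ : Ideal (𝓞 (κ.layer (n + t)))) ≠ ⊥)) => σ ^ p)).index ∣
      (powMonoidHom (α := NarrowClassGroup Fje) p).range.index :=
    index_sup_pow_dvd_index_range_pow_narrowClassGroup Fje (narrowRayClassField (κ.layer (n + t)) (top_ne_bot : (⊤ : Ideal (𝓞 (κ.layer (n + t)))) ≠ ⊥)) Nj (by rw [hNj]; exact le_sup_left) hIN p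
  have hNjrindex : (Nj ⊔ Subgroup.closure (Set.range fun σ : (narrowRayClassField (κ.layer (n + t)) (top_ne_bot : (⊤ : Ideal (𝓞 (κ.layer (n + t)))) ≠ ⊥)) ≃ₐ[Fje] (narrowRayClassField (κ.layer (n + t)) (top_ne_bot : (⊤ : Ideal (𝓞 (κ.layer (n + t)))) ≠ ⊥)) => σ ^ p)).index =
      (powMonoidHom (α := NarrowClassGroup Fje) p).range.index :=
    Nat.dvd_antisymm hCjr (by rw [hNj]; exact hDr)
  -- transport along `ρj`
  have hmapI : ∀ Q : MaximalSpectrum (𝓞 (narrowRayClassField (κ.layer (n + t)) (top_ne_bot : (⊤ : Ideal (𝓞 (κ.layer (n + t)))) ≠ ⊥))),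
      (Q.asIdeal.inertia ((narrowRayClassField (κ.layer (n + t)) (top_ne_bot : (⊤ : Ideal (𝓞 (κ.layer (n + t)))) ≠ ⊥)) ≃ₐ[Fje] (narrowRayClassField (κ.layer (n + t)) (top_ne_bot : (⊤ : Ideal (𝓞 (κ.layer (n + t)))) ≠ ⊥)))).map ρj = Q.asIdeal.inertia ((narrowRayClassField (κ.layer (n + t)) (top_ne_bot : (⊤ : Ideal (𝓞 (κ.layer (n + t)))) ≠ ⊥)) ≃ₐ[Bi] (narrowRayClassField (κ.layer (n + t)) (top_ne_bot : (⊤ : Ideal (𝓞 (κ.layer (n + t)))) ≠ ⊥))) ⊓ ρj.range := by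
    intro Q
    ext x
    constructor
    · rintro ⟨σ, hσ, rfl⟩
      exact ⟨fun y => hσ y, ⟨σ, rfl⟩⟩
    · rintro ⟨hgI, ⟨σ, rfl⟩⟩
      exact ⟨σ, fun y => hgI y, rfl⟩
  have hmapN : Nj.map ρj = ⁅Gj, Gj⁆ ⊔ ⨆ I ∈ 𝓘, I ⊓ Gj := by
    rw [hGj, hNj, Subgroup.map_sup, Subgroup.map_commutator, ← MonoidHom.range_eq_map, Subgroup.map_iSup, h𝓘def,
      iSup_range]
    simp_rw [hmapI]
  have hmapP : (Subgroup.closure (Set.range fun σ : (narrowRayClassField (κ.layer (n + t)) (top_ne_bot : (⊤ : Ideal (𝓞 (κ.layer (n + t)))) ≠ ⊥)) ≃ₐ[Fje] (narrowRayClassField (κ.layer (n + t)) (top_ne_bot : (⊤ : Ideal (𝓞 (κ.layer (n + t)))) ≠ ⊥)) => σ ^ p)).map ρj =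
      Subgroup.closure ((fun x : (narrowRayClassField (κ.layer (n + t)) (top_ne_bot : (⊤ : Ideal (𝓞 (κ.layer (n + t)))) ≠ ⊥)) ≃ₐ[Bi] (narrowRayClassField (κ.layer (n + t)) (top_ne_bot : (⊤ : Ideal (𝓞 (κ.layer (n + t)))) ≠ ⊥)) => x ^ p) '' (Gj : Set ((narrowRayClassField (κ.layer (n + t)) (top_ne_bot : (⊤ : Ideal (𝓞 (κ.layer (n + t)))) ≠ ⊥)) ≃ₐ[Bi] (narrowRayClassField (κ.layer (n + t)) (top_ne_bot : (⊤ : Ideal (𝓞 (κ.layer (n + t)))) ≠ ⊥))))) := by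
    rw [MonoidHom.map_closure]
    congr 1
    ext x
    constructor
    · rintro ⟨_, ⟨σ, rfl⟩, rfl⟩
      exact ⟨ρj σ, by rw [hGj]; exact ⟨σ, rfl⟩, by rw [map_pow]⟩
    · rintro ⟨y, hy, rfl⟩
      rw [hGj] at hy
      obtain ⟨σ, rfl⟩ := hy
      exact ⟨σ ^ p, ⟨σ, rfl⟩, by rw [map_pow]⟩
  have hrelr : ((⁅Gj, Gj⁆ ⊔ ⨆ I ∈ 𝓘, I ⊓ Gj) ⊔
      Subgroup.closure ((fun x : (narrowRayClassField (κ.layer (n + t)) (top_ne_bot : (⊤ : Ideal (𝓞 (κ.layer (n + t)))) ≠ ⊥)) ≃ₐ[Bi] (narrowRayClassField (κ.layer (n + t)) (top_ne_bot : (⊤ : Ideal (𝓞 (κ.layer (n + t)))) ≠ ⊥)) => x ^ p) '' (Gj : Set ((narrowRayClassField (κ.layer (n + t)) (top_ne_bot : (⊤ : Ideal (𝓞 (κ.layer (n + t)))) ≠ ⊥)) ≃ₐ[Bi] (narrowRayClassField (κ.layer (n + t)) (top_ne_bot : (⊤ : Ideal (𝓞 (κ.layer (n + t)))) ≠ ⊥)))))).relIndex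 Gj =
      (Nj ⊔ Subgroup.closure (Set.range fun σ : (narrowRayClassField (κ.layer (n + t)) (top_ne_bot : (⊤ : Ideal (𝓞 (κ.layer (n + t)))) ≠ ⊥)) ≃ₐ[Fje] (narrowRayClassField (κ.layer (n + t)) (top_ne_bot : (⊤ : Ideal (𝓞 (κ.layer (n + t)))) ≠ ⊥)) => σ ^ p)).index := by
    rw [← hmapN, ← hmapP, ← Subgroup.map_sup, hGj, MonoidHom.range_eq_map, Subgroup.relIndex_map_map_of_injective _ ⊤ hρj_inj,
      Subgroup.relIndex_top_right]
  refine ⟨Gj, hA'Gj, hGjindex, ?_⟩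
  rw [hrelr, hNjrindex, hrkFj]

end Literature.NumberTheory.IwasawaTheory

end
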